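import Mathlib
import Summits.HodgeConjecture.FermatCycles.HodgeFermatChiThreeB

/-!
# LEMMA E (m₀ = 3) in algebraic form: twisted moments of a CM type — part 1 (`HodgeFermat/TwistedMoment.lean`)

Tree copy (part 1 of 2) of the module `HodgeFermat/TwistedMoment.lean` of the sibling cell's standalone package
`run/shared/lean/pub/pub-hodgefermat/lean/HodgeFermat/` (554 lines, sha256 `fc1f2106c3deb52f…`), source lines 48–300 (characters as bare functions, the raw identity, evaluations 1–3, the ν-identity).
Filed by cell `pub-hfermat`, seat prover-1 gen-0, on the COORDINATOR KEEPER RULING of 2026-08-25 (gem sweep H1: take the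
off-gate kernel theorem `thmFstar` — `HodgeFermat/DecodingFinal.lean:29` — through the gate); this file is one link of the
minimal import closure of `thmFstar`.  The source module's declarations are VERBATIM those of the cell record
`check/DecodingFinal_standalone.lean` (27 bodies, 454 223 B, sha256 dca6f17de93119a6…, hub `lean check` rc 0, 130.1 s; pub-hodgefermat `CERT.md` l.978, GATE HF-G32).
Deviations from the source module, exhaustively: the `import` lines (tree modules `Summits.HodgeConjecture.FermatCycles.
HodgeFermat*` instead of `HodgeFermat.*`); this module docstring; one-line docstring added (gate lint) to `IsChar.of_mul`; the file ends at source l.300 with an `end` line (part 2 = `HodgeFermatTwistedMomentB.lean`).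
Every other line — in particular every declaration's statement and proof — is byte-identical to the source.
HONEST FRAMING: explicit algebraic cycles for specific Hodge classes on Fermat/Delsarte varieties; residual open instances
listed; no claim on general Hodge.  (This file is arithmetic of CM types; it claims nothing about cycles.)

The source module's docstring (TwistedMoment.lean l.3–46), verbatim:

## The twisted residue transform: LEMMA E (`m₀ = 3`) in algebraic form (build hodge-fermat, generation 31, HF-G31b)

`tables/DPRIME-THEOREM.md` §6 (LEMMA E at `m₀ = 3`) evaluates, for a triple `T = (a, b, c)` of level `m = 3n` and a
character `χ` of `(ℤ/m)ˣ`, the sum `Σ_t χ(t)·c_T(t)` entry by entry through the TWISTED RESIDUE TRANSFORM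
`c_χ(x) = Σ_{t unit} χ(t)·⟨tx⟩_m` [`transform`], and reads off that a coincidence of CM types `T ∼ T′` forces
`ν̂_T(ψ) = ν̂_{T′}(ψ)` (characters `χ = χ₃^± × ψ` ramified at `3`) and `μ̂_T(ψ) = μ̂_{T′}(ψ)` (characters `χ = 1 × ψ` of
`ℤ/n`) for every `ψ` outside a set `Bad` of vanishing moments.  `ChiThree.lean` (HF-G31) put the single instance
`χ = χ₃ × 1` into the kernel.  This file proves the WHOLE ALGEBRAIC HALF of LEMMA E at `m₀ = 3`, for characters with
values in an arbitrary commutative ring `R` given as bare functions `ℕ → R` [`IsChar`: periodic and multiplicative] —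
everything except the non-vanishing of the moments (which is analytic: `L(1, χ) ≠ 0`, generation 32+):

* THE RAW IDENTITY [`transform_sum_eq_of_sameType`]: for ANY weight `w : ℕ → R`, two zero-sum triples of the same CM
  type (third entries `≢ 0 (mod N)`) have `c_w(a) + c_w(b) + c_w(c) = c_w(a′) + c_w(b′) + c_w(c′)` — because the residue
  sums `⟨ta⟩ + ⟨tb⟩ + ⟨tc⟩ ∈ {N, 2N}` agree at every unit `t` [`rsum_cases` of `LemmaN.lean`].
* EVALUATION AT A UNIT [`transform_of_coprime`]: `c_χ(x) = χ̄(x)·S_N(χ)`, `S_N(χ) = Σ_u χ(u)u` [`moment`], by `u = tx`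
  [`sum_units_reindex`]; the conjugate value `χ̄(x)` is any ring element with `χ(x)χ̄(x) = 1` (data, not an inverse).
* EVALUATION AT A FIXED ENTRY [`transform_mul_of_fix`, `transform_eq_zero_of_fix`]: if a unit `j` fixes `x` then
  `χ(j)·c_χ(x) = c_χ(x)`; at level `3n` the unit `j = 1 + n(n mod 3) ≡ (2 mod 3, 1 mod n)` [`exists_unit`] fixes every
  multiple of `3` [`fix_of_three_dvd`], so `c_χ(3x′) = 0` whenever `χ(j) − 1` cancels.
* THE ν-IDENTITY [`nu_identity`]: `S_{3n}(χ)·Σ_{x ∈ T, 3∤x} χ̄(x) = S_{3n}(χ)·Σ_{x ∈ T′, 3∤x} χ̄(x)` for characters mod `3n`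
  ramified at `3`, entries divisible by `3` or units.  THEOREM (Σν) of `ChiThree.lean` is its instance `χ = χ₃`, `R = ℤ`
  [`S_mul_nu_eq`, re-derived here in twenty lines].
* EVALUATION AT `3x′` FOR A CHARACTER OF `ℤ/n` [`transform_of_three_mul`]: `c_ψ(3x′) = ψ̄(x′)·S′`,
  `S′ = Σ_{u unit mod 3n} ψ(u)·3⟨u⟩_n` [`moment₃`] (`⟨t·3x′⟩_{3n} = 3⟨tx′⟩_n`).
* THE μ-IDENTITY, two-constant form [`mu_identity`]: for `ψ` a character mod `n` (`n > 1`, `3 ∤ n`) and two triples with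
  zero sums mod `3n`, ALL ENTRIES UNITS MOD `n` (the scope of LEMMA E), of the same CM type:
  `Σ_{x ∈ T} w(x) = Σ_{x ∈ T′} w(x)`, `w(x) = ψ̄(x)·S_{3n}(ψ)` (`3 ∤ x`), `ψ̄(x/3)·S′` (`3 ∣ x`) [`muw`].
* THE CONSTANTS [`moment₃_eq`, `moment_three_mul`, `muw_eq`]: `S′ = 6·S_n(ψ)` and
  `S_{3n}(ψ) = 3(1 − ψ(3))·S_n(ψ) + 3n·M_n(ψ)` (`M_n = Σ_u ψ(u)` [`mass`], `= 0` for odd `ψ` [`mass_eq_zero_of_odd`]) —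
  the lifts `s, s + n, s + 2n` of a unit `s` of `ℤ/n` contain exactly two units of `ℤ/3n` [`sum_units_three_mul`,
  `three_cases`] and the third lift is `3⟨s·3⁻¹⟩_n` [`mu3_eq`, `sum_mu3`].  Hence the CANONICAL FORM of the μ-identity:
  `3·S_n(ψ)·Σ_{x ∈ T} e(x) + 3n·M_n(ψ)·Σ_{x ∈ T, 3∤x} ψ̄(x)` is a type invariant, with the weight (E0) of DPRIME §6
  `e(x) = (1 − ψ(3))·ψ̄(x)` (`3 ∤ x`), `2·ψ̄(x/3)` (`3 ∣ x`) [`mue`].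
So for an odd `ψ` with `S_n(ψ)` a non-zero-divisor, `Σ_{x ∈ T} e(x)` itself is a type invariant: this is LEMMA E (μ-part)
with `Bad = {S_n(ψ) = 0}`; `MuLegendre.lean` discharges the non-vanishing ELEMENTARILY for the real odd characters
`ψ = (·/p)`, `p ≡ 3 (mod 4)` (`S_p` is odd), giving the first μ-type kernel theorems.

LIGHT module: imports `ChiThree` (hence `LemmaN`) only — `units`, `coprime_mod_iff`, `InH`, `SameType`, `rsum`,
`rsum_cases`; `set_option autoImplicit false`; no `sorry`, no `decide`; axioms of every theorem =
[propext, Classical.choice, Quot.sound].  Numerical cross-read (second implementation) of the two-constant identity and of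
the constants: `code/gen31/mu_legendre_scan.py`, `results/gen31/local/mu_legendre_scan_131.txt` (part (A): `ψ = (·/n)` for the 166 odd
`n ≤ 501` with `3 ∤ n`; part (B): the two-constant identity on all same-type pairs at `3p`, `p ≤ 131` prime, 0 violations).
-/

set_option autoImplicit false

namespace HodgeFermat.KRFree.TwistedMoment

open Finset HodgeFermat.KRFree.LemmaN
open HodgeFermat.KRFree.ChiThree (units coprime_mod_iff card_units not_three_dvd_of_coprime)

variable {R : Type*} [CommRing R]

/-! ## Characters as bare functions, moments, the transform -/

/-- a character mod `N` as a bare function `ℕ → R`: periodic mod `N` and totally multiplicative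
(no condition at non-units; `χ 1 = 1` follows as soon as some value is a unit) -/
structure IsChar (N : ℕ) (χ : ℕ → R) : Prop where
  periodic : ∀ x, χ (x % N) = χ x
  mul : ∀ x y, χ (x * y) = χ x * χ y

/-- the first moment `S_N(χ) = Σ_{u unit} χ(u)·u` (units as residues `u < N`) -/
def moment (N : ℕ) (χ : ℕ → R) : R := ∑ u ∈ units N, χ u * (u : R)

/-- the mass `M_N(χ) = Σ_{u unit} χ(u)` -/
def mass (N : ℕ) (χ : ℕ → R) : R := ∑ u ∈ units N, χ u

/-- the twisted residue transform `c_w(x) = Σ_{t unit} w(t)·⟨tx⟩_N` of a single residue `x` -/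
def transform (N : ℕ) (w : ℕ → R) (x : ℕ) : R := ∑ t ∈ units N, w t * ((t * x % N : ℕ) : R)

/-- the second constant at a level `3n`: `S′ = Σ_{u unit mod 3n} ψ(u)·3⟨u⟩_n` -/
def moment₃ (n : ℕ) (ψ : ℕ → R) : R := ∑ u ∈ units (3 * n), ψ u * ((3 * (u % n) : ℕ) : R)

/-! ## Reindexing over the units -/

/-- multiplication by a unit `x` permutes the units of `ℤ/N` (residues `< N`) -/
lemma sum_units_reindex {M : Type*} [AddCommMonoid M] {N x : ℕ} (hN : 1 < N) (hx : Nat.Coprime x N)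
    (f : ℕ → M) : ∑ t ∈ units N, f (t * x % N) = ∑ t ∈ units N, f t := by
  obtain ⟨y, -, hy⟩ := Nat.exists_mul_mod_eq_one_of_coprime hx hN
  have hy' : Nat.Coprime y N := by
    have h1 : Nat.Coprime (x * y % N) N := by rw [hy]; exact Nat.coprime_one_left N
    exact Nat.Coprime.coprime_mul_left ((coprime_mod_iff _ _).mp h1)
  apply Finset.sum_nbij' (fun t => t * x % N) (fun t => t * y % N)
  · intro t ht
    simp only [units, mem_filter, mem_range] at ht ⊢
    exact ⟨Nat.mod_lt _ (by omega), (coprime_mod_iff _ _).mpr (Nat.Coprime.mul_left ht.2 hx)⟩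
  · intro t ht
    simp only [units, mem_filter, mem_range] at ht ⊢
    exact ⟨Nat.mod_lt _ (by omega), (coprime_mod_iff _ _).mpr (Nat.Coprime.mul_left ht.2 hy')⟩
  · intro t ht
    simp only [units, mem_filter, mem_range] at ht
    show t * x % N * y % N = t
    rw [Nat.mod_mul_mod, mul_assoc, Nat.mul_mod, hy, mul_one, Nat.mod_mod, Nat.mod_eq_of_lt ht.1]
  · intro t ht
    simp only [units, mem_filter, mem_range] at ht
    show t * y % N * x % N = t
    have hy2 : y * x % N = 1 := by rw [mul_comm]; exact hy
    rw [Nat.mod_mul_mod, mul_assoc, Nat.mul_mod, hy2, mul_one, Nat.mod_mod, Nat.mod_eq_of_lt ht.1]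
  · intro t _
    rfl

/-! ## The raw identity: a coincidence of CM types equalises every twisted transform -/

/-- `Σ_t w(t)·(⟨ta⟩ + ⟨tb⟩ + ⟨tc⟩) = c_w(a) + c_w(b) + c_w(c)` -/
lemma sum_mul_rsum (N : ℕ) (w : ℕ → R) (a b c : ℕ) :
    ∑ t ∈ units N, w t * (rsum N (a, b, c) t : R) = transform N w a + transform N w b + transform N w c := by
  simp only [transform, rsum, ← Finset.sum_add_distrib]
  refine Finset.sum_congr rfl (fun t _ => ?_)
  push_cast
  ring

/-- **THE RAW IDENTITY.**  Two zero-sum triples of the same CM type (third entries `≢ 0`) have the same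
`c_w(a) + c_w(b) + c_w(c)` for EVERY weight `w : ℕ → R` — the residue sums `⟨ta⟩ + ⟨tb⟩ + ⟨tc⟩ ∈ {N, 2N}` agree at
every unit `t` (`rsum_cases` of `LemmaN.lean`). -/
theorem transform_sum_eq_of_sameType {N : ℕ} (w : ℕ → R) {a b c a' b' c' : ℕ} (hN : 0 < N)
    (hs : N ∣ a + b + c) (hs' : N ∣ a' + b' + c') (hc0 : ¬ N ∣ c) (hc0' : ¬ N ∣ c')
    (hT : SameType N (a, b, c) (a', b', c')) :
    transform N w a + transform N w b + transform N w c
      = transform N w a' + transform N w b' + transform N w c' := by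
  have hR : ∀ t ∈ units N, rsum N (a, b, c) t = rsum N (a', b', c') t := by
    intro t ht
    simp only [units, mem_filter, mem_range] at ht
    have htc : ¬ N ∣ t * c := fun h => hc0 (Nat.Coprime.dvd_of_dvd_mul_left ht.2.symm h)
    have htc' : ¬ N ∣ t * c' := fun h => hc0' (Nat.Coprime.dvd_of_dvd_mul_left ht.2.symm h)
    obtain ⟨h1, h2⟩ := rsum_cases hN hs htc
    obtain ⟨h1', h2'⟩ := rsum_cases hN hs' htc'
    have h := hT t ht.2
    rw [h2, h2'] at h
    rcases h1 with e | e <;> rcases h1' with e' | e'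
    · omega
    · exact absurd (h.mp e) (by omega)
    · exact absurd (h.mpr e') (by omega)
    · omega
  have hsum : ∑ t ∈ units N, w t * (rsum N (a, b, c) t : R)
      = ∑ t ∈ units N, w t * (rsum N (a', b', c') t : R) :=
    Finset.sum_congr rfl (fun t ht => by rw [hR t ht])
  rwa [sum_mul_rsum, sum_mul_rsum] at hsum

/-! ## Character bookkeeping -/

namespace IsChar

variable {N : ℕ} {χ : ℕ → R}

/-- `χ(1) = 1` as soon as one value of `χ` is a unit -/
lemma map_one (hχ : IsChar N χ) {x : ℕ} {z : R} (h : χ x * z = 1) : χ 1 = 1 := by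
  have hu : χ 1 * (χ x * z) = χ x * z := by rw [← mul_assoc, ← hχ.mul, one_mul]
  rwa [h, mul_one] at hu

/-- `χ(t) = χ(tx mod N)·χ̄` whenever `χ(x)·χ̄ = 1` -/
lemma apply_eq_mul (hχ : IsChar N χ) {x : ℕ} {χb : R} (h : χ x * χb = 1) (t : ℕ) :
    χ t = χ (t * x % N) * χb := by
  rw [hχ.periodic, hχ.mul, mul_assoc, h, mul_one]

/-- periodic mod `N` ⟹ periodic mod every multiple `kN` -/
lemma periodic_mul (hχ : IsChar N χ) (k x : ℕ) : χ (x % (k * N)) = χ x := by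
  rw [← hχ.periodic (x % (k * N)), Nat.mod_mul_left_mod, hχ.periodic]

/-- a character mod `N` is a character mod `kN` -/
lemma of_mul (hχ : IsChar N χ) (k : ℕ) : IsChar (k * N) χ := ⟨hχ.periodic_mul k, hχ.mul⟩

end IsChar

/-! ## Evaluation 1: a unit entry — `c_χ(x) = χ̄(x)·S_N(χ)` -/

/-- substituting `u = tx`: `c_χ(x) = χ̄·S_N(χ)` for a unit `x` with `χ(x)χ̄ = 1` -/
theorem transform_of_coprime {N : ℕ} {χ : ℕ → R} (hχ : IsChar N χ) (hN : 1 < N) {x : ℕ}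
    (hx : Nat.Coprime x N) {χb : R} (hb : χ x * χb = 1) :
    transform N χ x = χb * moment N χ := by
  unfold transform moment
  rw [Finset.mul_sum]
  have key : ∀ t ∈ units N,
      χ t * ((t * x % N : ℕ) : R) = χb * (χ (t * x % N) * ((t * x % N : ℕ) : R)) := by
    intro t _
    rw [hχ.apply_eq_mul hb t]
    ring
  rw [Finset.sum_congr rfl key]
  exact sum_units_reindex hN hx (fun u => χb * (χ u * (u : R)))

/-! ## Evaluation 2: an entry fixed by a unit `j` — `χ(j)·c_χ(x) = c_χ(x)` -/

/-- if the unit `j` fixes `x` (`jx ≡ x`), the substitution `t ↦ tj` gives `χ(j)·c_χ(x) = c_χ(x)` -/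
theorem transform_mul_of_fix {N : ℕ} {χ : ℕ → R} (hχ : IsChar N χ) (hN : 1 < N) {x j : ℕ}
    (hj : Nat.Coprime j N) (hjx : j * x % N = x % N) :
    χ j * transform N χ x = transform N χ x := by
  unfold transform
  have key : ∑ t ∈ units N, χ (t * j % N) * (((t * j % N) * x % N : ℕ) : R)
      = ∑ t ∈ units N, χ t * ((t * x % N : ℕ) : R) :=
    sum_units_reindex hN hj (fun u => χ u * ((u * x % N : ℕ) : R))
  have pt : ∀ t ∈ units N,
      χ (t * j % N) * (((t * j % N) * x % N : ℕ) : R) = χ j * (χ t * ((t * x % N : ℕ) : R)) := by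
    intro t _
    have e : (t * j % N) * x % N = t * x % N := by
      rw [Nat.mod_mul_mod, mul_assoc, Nat.mul_mod, hjx, ← Nat.mul_mod]
    rw [hχ.periodic, hχ.mul, e]
    ring
  rw [Finset.sum_congr rfl pt, ← Finset.mul_sum] at key
  exact key

/-- … hence `c_χ(x) = 0` when `χ(j) − 1` cancels (e.g. `χ(j) ≠ 1` in a domain, or `χ(j) = −1` and `2` regular) -/
theorem transform_eq_zero_of_fix {N : ℕ} {χ : ℕ → R} (hχ : IsChar N χ) (hN : 1 < N) {x j : ℕ}
    (hj : Nat.Coprime j N) (hjx : j * x % N = x % N) (hreg : ∀ z : R, χ j * z = z → z = 0) :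
    transform N χ x = 0 :=
  hreg _ (transform_mul_of_fix hχ hN hj hjx)

/-- at a level `3n`, `3 ∤ n`: the unit `j = 1 + n·(n mod 3)` has `j ≡ 2 (mod 3)`, `j ≡ 1 (mod n)` -/
lemma exists_unit {n : ℕ} (h3n : ¬ 3 ∣ n) :
    ∃ j, Nat.Coprime j (3 * n) ∧ j % 3 = 2 ∧ j % n = 1 % n := by
  refine ⟨1 + n * (n % 3), ?_, ?_, by rw [Nat.add_mul_mod_self_left]⟩
  · apply Nat.Coprime.mul_right
    · have h : n % 3 = 1 ∨ n % 3 = 2 := by omega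
      apply Nat.coprime_comm.mp
      apply (Nat.Prime.coprime_iff_not_dvd Nat.prime_three).mpr
      rcases h with h | h <;> rw [h] <;> omega
    · have h1 : Nat.Coprime ((1 + n * (n % 3)) % n) n := by
        rw [Nat.add_mul_mod_self_left]; exact (coprime_mod_iff 1 n).mpr (Nat.coprime_one_left n)
      exact (coprime_mod_iff _ n).mp h1
  · have h : n % 3 = 1 ∨ n % 3 = 2 := by omega
    rcases h with h | h <;> rw [h] <;> omega

/-- a unit `j ≡ 1 (mod n)` fixes every multiple of `3` modulo `3n` -/
lemma fix_of_three_dvd {n x j : ℕ} (hx : 3 ∣ x) (hj : j % n = 1 % n) :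
    j * x % (3 * n) = x % (3 * n) := by
  obtain ⟨x', rfl⟩ := hx
  have h : j * x' % n = x' % n := by
    rw [Nat.mul_mod, hj, ← Nat.mul_mod, one_mul]
  have e : j * (3 * x') = 3 * (j * x') := by ring
  rw [e, Nat.mul_mod_mul_left, h, ← Nat.mul_mod_mul_left]

/-! ## The ν-identity (characters ramified at 3) -/

/-- weight of an entry in the ν-identity: `χ̄(x)` for `3 ∤ x`, `0` for `3 ∣ x` -/
def nuw (χb : ℕ → R) (x : ℕ) : R := if 3 ∣ x then 0 else χb x

/-- **THE ν-IDENTITY** (LEMMA E, `m₀ = 3`, characters `χ = χ₃^± × ψ` not factoring through `ℤ/n`).  Let `χ` be a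
character mod `3n` (`3 ∤ n`) with a "conjugate" `χ̄` (`χ(x)χ̄(x) = 1` on units) such that `χ(j) − 1` cancels for the
units `j ≡ 1 (mod n)`, `j ≡ 2 (mod 3)`.  For two zero-sum triples of the same CM type whose entries are divisible by `3`
or units mod `3n` (third entries `≢ 0`):  `S_{3n}(χ)·Σ_{x ∈ T, 3 ∤ x} χ̄(x) = S_{3n}(χ)·Σ_{x ∈ T′, 3 ∤ x} χ̄(x)`. -/
theorem nu_identity {n : ℕ} {χ χb : ℕ → R} (hχ : IsChar (3 * n) χ) (hn : 0 < n) (h3n : ¬ 3 ∣ n)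
    (hb : ∀ x, Nat.Coprime x (3 * n) → χ x * χb x = 1)
    (hram : ∀ j, Nat.Coprime j (3 * n) → j % 3 = 2 → j % n = 1 % n → ∀ z : R, χ j * z = z → z = 0)
    {a b c a' b' c' : ℕ} (hs : 3 * n ∣ a + b + c) (hs' : 3 * n ∣ a' + b' + c')
    (ha : 3 ∣ a ∨ Nat.Coprime a (3 * n)) (hb_ : 3 ∣ b ∨ Nat.Coprime b (3 * n))
    (hc : 3 ∣ c ∨ Nat.Coprime c (3 * n)) (ha' : 3 ∣ a' ∨ Nat.Coprime a' (3 * n))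
    (hb' : 3 ∣ b' ∨ Nat.Coprime b' (3 * n)) (hc' : 3 ∣ c' ∨ Nat.Coprime c' (3 * n))
    (hc0 : ¬ 3 * n ∣ c) (hc0' : ¬ 3 * n ∣ c') (hT : SameType (3 * n) (a, b, c) (a', b', c')) :
    moment (3 * n) χ * (nuw χb a + nuw χb b + nuw χb c)
      = moment (3 * n) χ * (nuw χb a' + nuw χb b' + nuw χb c') := by
  have h1m : 1 < 3 * n := by omega
  obtain ⟨j, hj, hj3, hjn⟩ := exists_unit h3n
  have ev : ∀ x, (3 ∣ x ∨ Nat.Coprime x (3 * n)) → transform (3 * n) χ x = nuw χb x * moment (3 * n) χ := by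
    intro x hx
    unfold nuw
    by_cases h3 : 3 ∣ x
    · rw [if_pos h3, zero_mul]
      exact transform_eq_zero_of_fix hχ h1m hj (fix_of_three_dvd h3 hjn) (hram j hj hj3 hjn)
    · rw [if_neg h3]
      have hx' : Nat.Coprime x (3 * n) := hx.resolve_left h3
      exact transform_of_coprime hχ h1m hx' (hb x hx')
  have key := transform_sum_eq_of_sameType χ (by omega) hs hs' hc0 hc0' hT
  rw [ev a ha, ev b hb_, ev c hc, ev a' ha', ev b' hb', ev c' hc'] at key
  linear_combination key

/-! ## Evaluation 3: an entry `3x′` against a character of `ℤ/n` — `c_ψ(3x′) = ψ̄(x′)·S′` -/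

/-- for a character `ψ` mod `n` viewed mod `3n` and `x′` a unit mod `n`: `c_ψ(3x′) = ψ̄(x′)·S′`,
`S′ = Σ_{u unit mod 3n} ψ(u)·3⟨u⟩_n` -/
theorem transform_of_three_mul {n : ℕ} {ψ : ℕ → R} (hψ : IsChar n ψ) (h1n : 1 < n) (h3n : ¬ 3 ∣ n)
    {x' : ℕ} (hx' : Nat.Coprime x' n) {ψb : R} (hb : ψ x' * ψb = 1) :
    transform (3 * n) ψ (3 * x') = ψb * moment₃ n ψ := by
  -- a representative x'' ≡ x' (mod n) that is a unit mod 3n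
  obtain ⟨x'', hx''n, hx''u⟩ : ∃ x'', x'' % n = x' % n ∧ Nat.Coprime x'' (3 * n) := by
    by_cases h3 : 3 ∣ x'
    · refine ⟨x' + n, by rw [Nat.add_mod_right], Nat.Coprime.mul_right ?_ ?_⟩
      · exact Nat.coprime_comm.mp ((Nat.Prime.coprime_iff_not_dvd Nat.prime_three).mpr (by omega))
      · exact (coprime_mod_iff _ n).mp (by rw [Nat.add_mod_right]; exact (coprime_mod_iff _ n).mpr hx')
    · refine ⟨x', rfl, Nat.Coprime.mul_right ?_ hx'⟩
      exact Nat.coprime_comm.mp ((Nat.Prime.coprime_iff_not_dvd Nat.prime_three).mpr h3)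
  have hψ3 : IsChar (3 * n) ψ := hψ.of_mul 3
  have hb'' : ψ x'' * ψb = 1 := by rw [← hψ.periodic x'', hx''n, hψ.periodic]; exact hb
  have h33 : 3 * x'' % (3 * n) = 3 * x' % (3 * n) := by
    rw [Nat.mul_mod_mul_left, Nat.mul_mod_mul_left, hx''n]
  have htr : transform (3 * n) ψ (3 * x') = transform (3 * n) ψ (3 * x'') := by
    unfold transform
    refine Finset.sum_congr rfl (fun t _ => ?_)
    rw [Nat.mul_mod, ← h33, ← Nat.mul_mod]
  rw [htr]
  unfold transform moment₃
  rw [Finset.mul_sum]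
  have key : ∀ t ∈ units (3 * n), ψ t * ((t * (3 * x'') % (3 * n) : ℕ) : R)
      = ψb * (ψ (t * x'' % (3 * n)) * ((3 * ((t * x'' % (3 * n)) % n) : ℕ) : R)) := by
    intro t _
    have e1 : t * (3 * x'') % (3 * n) = 3 * ((t * x'' % (3 * n)) % n) := by
      rw [Nat.mul_left_comm, Nat.mul_mod_mul_left, Nat.mod_mul_left_mod]
    rw [e1, hψ3.apply_eq_mul hb'' t]
    ring
  rw [Finset.sum_congr rfl key]
  exact sum_units_reindex (by omega) hx''u (fun u => ψb * (ψ u * ((3 * (u % n) : ℕ) : R)))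

end HodgeFermat.KRFree.TwistedMoment
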